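import Literature.AlgebraicGeometry.Frobenioids.ArchimedeanCoAngular
import HarnessLib

/-!
# Frobenioids II, Example 3.3 (ii): co-angular ⟹ naively co-angular; morphisms of Frobenius type in `C₀`

Mochizuki, *The geometry of Frobenioids II: poly-Frobenioids*, Kyushu J. Math. **62** (2008)
401–460, §3, Example 3.3 (ii), author's text p. 28 [cite: MochizukiFrdII2008, Ex 3.3 (ii) p.28], and
[FrdI] Def. 1.3 (ii) for the pre-Frobenioid `C₀ → F_{Φ₀}` of abc-iut-L1-t6.  PROOF-ONLY file (no
definition).  Contents (all PROVED): the converse half of "a morphism of `C` is co-angular if and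
only if it is naively co-angular" for `C₀`, by exhibiting, for a morphism whose shadow does not fill
its target's, a factorisation `φ = α ∘ β ∘ γ` through a non-invertible isometric pre-step `β`
(`isNaivelyCoAngular_of_isCoAngular`, `isCoAngular_iff_isNaivelyCoAngular`); the description of
morphisms of Frobenius type (`isFrobeniusType_iff`, `homImage_eq_pullRegion_of_isFrobeniusType`);
and [FrdI] Def. 1.3 (ii) for `C₀`: existence of morphisms of Frobenius type of every degree out of
every object (`exists_isFrobeniusType`) and their essential uniqueness (`isFrobeniusType_unique`).
-/

namespace Literature.AlgebraicGeometry.Frobenioids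

open CategoryTheory Set Function Topology
open scoped Pointwise

noncomputable section

namespace ArchFrd

namespace C0

variable {X Y Z : C0}

/-! ### Small tools -/

/-- The twist along an identity arrow is the identity on angular parts.
[cite: MochizukiFrdII2008, Def 3.1 (iv) p.24] -/
theorem twist_id_image (K : D0) (B : Set (normOneSubgroup ℂ)) :
    (fun z : normOneSubgroup ℂ => unitPart ℂ ((𝟙 K : K ⟶ K).act (z : ℂˣ))) '' B = B := by
  have : (fun z : normOneSubgroup ℂ => unitPart ℂ ((𝟙 K : K ⟶ K).act (z : ℂˣ))) = id := by
    funext z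
    unfold D0.Hom.act
    rw [D0.twists_id, D0.galAct_false, unitPart_normOne_coe]
    rfl
  rw [this, Set.image_id]

/-- A region whose angular part and tip are those of `c · A^{⊗d}` IS `c · A^{⊗d}` (as a set).
[cite: MochizukiFrdII2008, Def 3.1 (iii) p.24] -/
theorem smul_carrier_pow_eq (A A' : AngularRegion ℂ) (c : ℂˣ) (n : ℕ)
    (hdir : unitPart ℂ c • A.dir ^ (n + 1) = A'.dir) (htip : absHom ℂ c * A.tip ^ (n + 1) = A'.tip) :
    c • A.carrier ^ (n + 1) = A'.carrier := by
  ext u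
  rw [Set.mem_smul_set_iff_inv_smul_mem, smul_eq_mul, A.mem_carrier_pow_iff, A'.mem_carrier_polar_iff,
    ← hdir, ← htip, unitPart_mul, map_mul, unitPart_inv, map_inv, Set.mem_smul_set_iff_inv_smul_mem,
    smul_eq_mul, inv_mul_le_iff_le_mul]

/-- The complex/real bookkeeping for an object built over a complex base.
[cite: MochizukiFrdII2008, Def 3.1 (v) p.24] -/
theorem isIsotropic_of_isReal_absurd (hX : X.IsComplexObj) (A : AngularRegion ℂ) :
    X.base = D0.real → A.IsIsotropic := fun h => absurd (hX.symm.trans h) (by decide)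

/-! ### Co-angular ⟹ naively co-angular -/

/-- **Co-angular ⇒ naively co-angular** (Ex. 3.3 (ii)): if the shadow `(c/|c|) · B^d` of
`φ = (f, d, c)` (complex domain) were a proper subset of the twisted angular part of the target, then
`φ` would factor as `X →(𝟙,d,c)→ X₁ →(𝟙,1,1)→ X₂ →(f,1,1)→ Y` with `X₁ = ((c/|c|) B^d, tip_Y)`,
`X₂ = A_Y|_f`, the middle arrow being a non-invertible isometric pre-step.
[cite: MochizukiFrdII2008, Ex 3.3 (ii) p.28] -/
theorem isNaivelyCoAngular_of_isCoAngular (φ : X ⟶ Y) (h : PreFrobenioid.IsCoAngular toElem φ) :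
    IsNaivelyCoAngular φ := by
  intro hX
  rw [image_unitPart_homImage, image_unitPart_pullRegion]
  by_contra hne
  -- the two auxiliary objects
  have hd : (degFr φ : ℕ) = (degFr φ).natPred + 1 := (PNat.natPred_add_one _).symm
  obtain ⟨A₁, hA₁d, hA₁t⟩ := exists_angularRegion
    (B := unitPart ℂ (scalar φ) • X.region.dir ^ (degFr φ : ℕ))
    (isOpen_smul _ (by rw [hd]; exact isOpen_pow X.region.isOpen_dir _))
    (isConnected_smul _ (by rw [hd]; exact isConnected_pow X.region.isConnected_dir _))
    Y.region.tip
  obtain ⟨A₂, hA₂c, hA₂t, hA₂d, -⟩ := exists_pulledRegion Y (Base φ)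
  let X₁ : C0 := ⟨X.base, A₁, isIsotropic_of_isReal_absurd hX A₁⟩
  let X₂ : C0 := ⟨X.base, A₂, isIsotropic_of_isReal_absurd hX A₂⟩
  -- the three arrows
  obtain ⟨A₁', hA₁'c, hA₁'t, hA₁'d, -⟩ := exists_pulledRegion X₁ (𝟙 X.base)
  rw [twist_id_image] at hA₁'d
  obtain ⟨γ, hγb, hγd, hγc⟩ := exists_hom X X₁ (𝟙 X.base) (degFr φ) φ.scalar_mem hA₁'c
    (by rw [hA₁'d]; exact hA₁d.symm.subset)
    (by rw [hA₁'t]; change _ ≤ ((A₁.tip : PosReal) : ℝ); rw [hA₁t]; exact norm_scalar_mul_tip_pow_le φ)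
  obtain ⟨A₂', hA₂'c, hA₂'t, hA₂'d, -⟩ := exists_pulledRegion X₂ (𝟙 X.base)
  rw [twist_id_image] at hA₂'d
  obtain ⟨β, hβb, hβd, hβc⟩ := exists_hom X₁ X₂ (𝟙 X.base) 1 (one_mem _) hA₂'c
    (by
      rw [hA₂'d, unitPart_one, one_smul, PNat.one_coe, pow_one]
      change A₁.dir ⊆ A₂.dir
      rw [hA₁d, hA₂d]
      exact (hom_conditions φ hA₂c).1.trans hA₂d.subset)
    (by
      rw [hA₂'t, Units.val_one, norm_one, one_mul, PNat.one_coe, pow_one]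
      change ((A₁.tip : PosReal) : ℝ) ≤ ((A₂.tip : PosReal) : ℝ)
      rw [hA₁t, hA₂t])
  obtain ⟨α, hαb, hαd, hαc⟩ := exists_hom X₂ Y (Base (X := X) (Y := Y) φ) 1 (one_mem _) hA₂c
    (by rw [unitPart_one, one_smul, PNat.one_coe, pow_one])
    (by rw [Units.val_one, norm_one, one_mul, PNat.one_coe, pow_one]; exact le_of_eq rfl)
  -- the factorisation
  have hfac : γ ≫ β ≫ α = φ := by
    refine hom_ext ?_ ?_ ?_
    · rw [base_comp', base_comp', hγb, hβb, hαb, Category.id_comp, Category.id_comp]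
    · rw [degFr_comp', degFr_comp', hγd, hβd, hαd, mul_one, mul_one]
    · rw [scalar_comp', scalar_comp', degFr_comp', hγb, hβb, hγc, hβc, hαc, hαd, hβd]
      simp only [map_one, mul_one, one_mul, PNat.one_coe, pow_one]
  have hα : PreFrobenioid.IsLinear toElem α := hαd
  have hβp : PreFrobenioid.IsPreStep toElem β :=
    ⟨hβd, by rw [isBaseIso_iff, hβb]; infer_instance⟩
  have hβi : PreFrobenioid.IsIsometry toElem β := by
    rw [isIsometry_iff, hβc, hβd, Units.val_one, norm_one, one_mul, PNat.one_coe, pow_one]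
    change ((A₁.tip : PosReal) : ℝ) = ((A₂.tip : PosReal) : ℝ)
    rw [hA₁t, hA₂t]
  have hγ : PreFrobenioid.IsBaseIso toElem γ := by rw [isBaseIso_iff, hγb]; infer_instance
  haveI : IsIso β := h γ β α hfac hα hβi hβp (Or.inr hγ)
  -- an invertible `β` forces the shadows to agree
  obtain ⟨-, -, hfull⟩ := of_isIso β
  have := congrArg (Set.image (unitPart ℂ)) hfull
  rw [image_unitPart_smul, hβc, unitPart_one, one_smul, hβb, ← hA₂'c, A₂'.image_unitPart_carrier,
    hA₂'d, AngularRegion.image_unitPart_carrier] at this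
  change A₁.dir = A₂.dir at this
  rw [hA₁d, hA₂d] at this
  exact hne this

/-- **Ex. 3.3 (ii), second claim, for `C₀`**: a morphism is co-angular in the sense of [FrdI]
Def. 1.2 (iii) iff it is naively co-angular. [cite: MochizukiFrdII2008, Ex 3.3 (ii) p.28] -/
theorem isCoAngular_iff_isNaivelyCoAngular (φ : X ⟶ Y) :
    PreFrobenioid.IsCoAngular toElem φ ↔ IsNaivelyCoAngular φ :=
  ⟨isNaivelyCoAngular_of_isCoAngular φ, isCoAngular_of_isNaivelyCoAngular φ⟩

/-! ### Morphisms of Frobenius type -/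

/-- **Morphisms of Frobenius type in `C₀`** ([FrdI] Def. 1.2 (iii): LB-invertible base-isomorphisms):
`φ = (f, d, c)` is of Frobenius type iff it is naively co-angular, `|c| · tip^d = tip'` and `f` is
an isomorphism of `D₀`. [cite: MochizukiFrdII2008, Ex 3.3 (ii) p.28] -/
theorem isFrobeniusType_iff (φ : X ⟶ Y) :
    PreFrobenioid.IsFrobeniusType toElem φ ↔
      IsNaivelyCoAngular φ ∧ ‖(scalar φ : ℂ)‖ * X.tip ^ (degFr φ : ℕ) = Y.tip ∧ IsIso (Base φ) := by
  unfold PreFrobenioid.IsFrobeniusType PreFrobenioid.IsLBInvertible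
  rw [isCoAngular_iff_isNaivelyCoAngular, isIsometry_iff, isBaseIso_iff, and_assoc]

/-- The shadow of a morphism of Frobenius type fills its target's (also over a real base, where all
angular parts are full). [cite: MochizukiFrdII2008, Ex 3.3 (ii) p.28] -/
theorem shadow_eq_of_isFrobeniusType (φ : X ⟶ Y) (hφ : PreFrobenioid.IsFrobeniusType toElem φ) :
    unitPart ℂ (scalar φ) • X.region.dir ^ (degFr φ : ℕ) =
      (fun z : normOneSubgroup ℂ => unitPart ℂ ((Base φ).act (z : ℂˣ))) '' Y.region.dir := by
  rcases D0.isReal_or_isComplex X.base with hX | hX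
  · have hY : Y.IsRealObj := isRealObj_of_hom φ hX
    rw [show X.region.dir = univ from isNaivelyIsotropic_of_isRealObj hX,
      show Y.region.dir = univ from isNaivelyIsotropic_of_isRealObj hY,
      Set.univ_pow (PNat.ne_zero _), Set.smul_set_univ, eq_comm, Set.eq_univ_iff_forall]
    intro z
    exact ⟨unitPart ℂ ((Base φ).act (z : ℂˣ)), trivial, twist_twist _ z⟩
  · have := ((isFrobeniusType_iff φ).1 hφ).1 hX
    rwa [image_unitPart_homImage, image_unitPart_pullRegion] at this

/-- **A morphism of Frobenius type maps `c · A_L^{⊗d}` ONTO `A_K|_L`.**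
[cite: MochizukiFrdII2008, Ex 3.3 (ii) p.28] -/
theorem homImage_eq_pullRegion_of_isFrobeniusType (φ : X ⟶ Y)
    (hφ : PreFrobenioid.IsFrobeniusType toElem φ) : Hom.image φ = pullRegion Y (Base φ) := by
  obtain ⟨A', hA'c, hA't, hA'd, -⟩ := exists_pulledRegion Y (Base φ)
  unfold Hom.image
  rw [← hA'c, ← (Hom.degFr φ).natPred_add_one]
  refine smul_carrier_pow_eq X.region A' (scalar φ) _ ?_ ?_
  · rw [(Hom.degFr φ).natPred_add_one, hA'd]
    exact shadow_eq_of_isFrobeniusType φ hφ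
  · apply Subtype.ext
    rw [Positive.val_mul, Positive.val_pow, coe_absHom, hA't, (Hom.degFr φ).natPred_add_one]
    exact ((isFrobeniusType_iff φ).1 hφ).2.1

/-! ### [FrdI] Definition 1.3 (ii) for `C₀` -/

/-- **Def. 1.3 (ii), existence, for `C₀`**: out of every object and in every degree `n` there is a
morphism of Frobenius type, namely `(𝟙, n, 1) : (K, B, λ) → (K, B^n, λ^n)`.
[cite: MochizukiFrdII2008, Ex 3.3 (ii) p.28] -/
theorem exists_isFrobeniusType (X : C0) (n : ℕ+) :
    ∃ (Y : C0) (φ : X ⟶ Y), PreFrobenioid.IsFrobeniusType toElem φ ∧ degFr φ = n := by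
  have hn : (n : ℕ) = n.natPred + 1 := (PNat.natPred_add_one _).symm
  obtain ⟨A, hAd, hAt⟩ := exists_angularRegion (B := X.region.dir ^ (n : ℕ))
    (by rw [hn]; exact isOpen_pow X.region.isOpen_dir _)
    (by rw [hn]; exact isConnected_pow X.region.isConnected_dir _) (X.region.tip ^ (n : ℕ))
  have hA : X.base = D0.real → A.IsIsotropic := fun h => by
    change A.dir = univ
    rw [hAd, show X.region.dir = univ from X.isIsotropic_of_isReal h, Set.univ_pow (PNat.ne_zero _)]
  let Y : C0 := ⟨X.base, A, hA⟩
  obtain ⟨A', hA'c, hA't, hA'd, -⟩ := exists_pulledRegion Y (𝟙 X.base)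
  rw [twist_id_image] at hA'd
  obtain ⟨φ, hφb, hφd, hφc⟩ := exists_hom X Y (𝟙 X.base) n (one_mem _) hA'c
    (by rw [hA'd, unitPart_one, one_smul]; exact hAd.symm.subset)
    (by
      rw [hA't, Units.val_one, norm_one, one_mul]
      change _ ≤ ((A.tip : PosReal) : ℝ)
      rw [hAt, Positive.val_pow]; rfl)
  refine ⟨Y, φ, (isFrobeniusType_iff φ).2 ⟨?_, ?_, ?_⟩, hφd⟩
  · intro _
    rw [image_unitPart_homImage, image_unitPart_pullRegion, hφc, unitPart_one, one_smul, hφd, hφb,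
      twist_id_image]
    exact hAd.symm
  · rw [hφc, hφd, Units.val_one, norm_one, one_mul]
    change _ = ((A.tip : PosReal) : ℝ)
    rw [hAt, Positive.val_pow]; rfl
  · rw [hφb]; infer_instance

/-- **Def. 1.3 (ii), essential uniqueness, for `C₀`**: two morphisms of Frobenius type of the same
degree out of the same object differ by a unique isomorphism of their codomains (here:
`(f_φ⁻¹ f_ψ, 1, f_φ(c_ψ c_φ⁻¹))`). [cite: MochizukiFrdII2008, Ex 3.3 (ii) p.28] -/
theorem isFrobeniusType_unique {Y' : C0} (φ : X ⟶ Y) (ψ : X ⟶ Y')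
    (hφ : PreFrobenioid.IsFrobeniusType toElem φ) (hψ : PreFrobenioid.IsFrobeniusType toElem ψ)
    (hd : degFr φ = degFr ψ) : ∃ e : Y ≅ Y', φ ≫ e.hom = ψ := by
  haveI : IsIso (Base φ) := ((isFrobeniusType_iff φ).1 hφ).2.2
  haveI : IsIso (Base ψ) := ((isFrobeniusType_iff ψ).1 hψ).2.2
  have himφ := homImage_eq_pullRegion_of_isFrobeniusType φ hφ
  have himψ := homImage_eq_pullRegion_of_isFrobeniusType ψ hψ
  -- `A_Y = f_φ(c_φ) · f_φ(A_X^{⊗d})`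
  have hY : Y.region.carrier =
      (Base φ).act (scalar φ) • (Base φ).act '' (X.region.carrier ^ (degFr φ : ℕ)) := by
    rw [← act_image_smul]
    change _ = (Base φ).act '' Hom.image φ
    rw [himφ]
    unfold pullRegion
    rw [act_image_act_image]
  -- the comparison arrow `χ = (f_φ⁻¹ ≫ f_ψ, 1, f_φ(c_ψ c_φ⁻¹))` is full
  have hset : (Base φ).act (scalar ψ * (scalar φ)⁻¹) • Y.region.carrier =
      pullRegion Y' (inv (Base φ) ≫ Base ψ) := by
    rw [pullRegion_comp, D0.act_inv, hY, smul_smul, ← map_mul, inv_mul_cancel_right]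
    change _ = (Base φ).act '' pullRegion Y' (Base ψ)
    rw [← himψ]
    unfold Hom.image
    rw [act_image_smul]
    change _ = _ • (Base φ).act '' (X.region.carrier ^ (degFr ψ : ℕ))
    rw [← hd]
  have hmem : (Base φ).act (scalar ψ * (scalar φ)⁻¹) ∈ D0.scalars Y.base := by
    rw [← D0.act_inv (Base φ)]
    exact act_mem_scalars _ (mul_mem ψ.scalar_mem (inv_mem φ.scalar_mem))
  let χ : Y ⟶ Y' := ⟨inv (Base φ) ≫ Base ψ, 1, (Base φ).act (scalar ψ * (scalar φ)⁻¹), hmem,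
    by rw [PNat.one_coe, pow_one]; exact hset.subset⟩
  haveI : IsIso (Base χ) := by change IsIso (inv (Base φ) ≫ Base ψ); infer_instance
  haveI : IsIso χ := isIso_of χ rfl hset
  refine ⟨asIso χ, hom_ext ?_ ?_ ?_⟩
  · change Base φ ≫ inv (Base φ) ≫ Base ψ = Base ψ
    rw [IsIso.hom_inv_id_assoc]
  · change degFr φ * 1 = degFr ψ
    rw [mul_one, hd]
  · change (Base φ).act ((Base φ).act (scalar ψ * (scalar φ)⁻¹)) * scalar φ ^ ((1 : ℕ+) : ℕ) = scalar ψ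
    rw [D0.galAct_galAct, PNat.one_coe, pow_one, inv_mul_cancel_right]

end C0

end ArchFrd

end

end Literature.AlgebraicGeometry.Frobenioids
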